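import Summits.QuantumFields.YangMills.Theorems.ChatterjeeMassGapTorusAxialAdjacentPairSearch
import Literature.MathematicalPhysics.QuantumFieldTheory.StrongCouplingClustering
import HarnessLib

/-!
# Support rigidity for the distance-two coplanar pair, I: temporal slabs (item 8941 lane)

Seat ym-dw-p1 g8 (target T2 of ym-idea-4 g7): the truncated correlation of `A = P_{0,(0,1)}` and
`B₂ = P_{2e₀,(0,1)}`, i.e. the axial two-point function `f_{β,μ}(2e₀)`. Its leading
strong-coupling order is governed by the CONNECTED families of at most fourteen plaquettes of
`ℤ⁴` through `A, B₂` without private bonds; parts I–III prove that these are exactly the four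
`3×1×1` tubes `∂([0,3]_0 × [0,1]_1 × I_j)`, `j ∈ {2,3}`, `I ∈ {[0,1],[-1,0]}` — by a structural
slab count instead of a kernel search (an independent exhaustive search, 376 686 nodes, confirms
it). This part: a temporal bond `(y, 0)` lies only in temporal plaquettes of its own time slab
(`temporal_of_mem`); two temporal bonds determine a temporal plaquette (`eq_of_two_temporal`);
**`four_in_slab`** — in a family without private bonds, a temporal plaquette of slab `k` comes
with three more temporal plaquettes of slab `k`; **`exists_slab_one`** — if a bond of `A` is
joined to a bond of `B₂` through the family, the family has a temporal plaquette in slab `1`.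
Pure lattice combinatorics; no statement about Gibbs states; no mass gap is claimed.
-/

noncomputable section

open Finset
open Literature.MathematicalPhysics.QuantumLattice (ZdEdge ZdPlaquette plaquetteEdges)
open Literature.MathematicalPhysics.QuantumFieldTheory (LinkAdj)
open Literature.Probability.LatticeModels (Site)
open Summit.QuantumFields.YangMills.Theorems.S28OneBitBox (lt01 lt02 lt12)

namespace Summit.QuantumFields.YangMills.Theorems.S28DistanceTwo

/-! ## Bonds of a plaquette -/

/-- The four bonds of a plaquette, as a disjunction. [folklore] -/
theorem mem_plaquetteEdges_iff {d : ℕ} (p : ZdPlaquette d) (ℓ : ZdEdge d) :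
    ℓ ∈ plaquetteEdges p ↔ ℓ = (p.1, p.2.1.1) ∨ ℓ = (p.1 + Pi.single p.2.1.1 1, p.2.1.2) ∨
      ℓ = (p.1 + Pi.single p.2.1.2 1, p.2.1.1) ∨ ℓ = (p.1, p.2.1.2) := by
  simp only [plaquetteEdges, Finset.mem_insert, Finset.mem_singleton]

/-- Two plaquettes with the same base point and the same plane labels are equal. [folklore] -/
theorem plaquette_ext {d : ℕ} {p q : ZdPlaquette d} (h1 : p.1 = q.1) (h2 : p.2.1.1 = q.2.1.1)
    (h3 : p.2.1.2 = q.2.1.2) : p = q :=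
  Prod.ext h1 (Subtype.ext (Prod.ext h2 h3))

/-- The second plane label of a temporal plaquette (`i = 0`) is non-zero. [folklore] -/
theorem snd_ne_zero {p : ZdPlaquette 4} (ht : p.2.1.1 = 0) : p.2.1.2 ≠ 0 := by
  intro h
  have := p.2.2
  rw [ht, h] at this
  exact lt_irrefl _ this

/-- The second plane label of any plaquette is non-zero. [folklore] -/
theorem snd_ne_zero' (p : ZdPlaquette 4) : p.2.1.2 ≠ 0 := by
  intro h
  have := p.2.2
  rw [h] at this
  exact (Fin.not_lt_zero _) this

/-- Unit vectors: `e_j = e_{j'}` only for `j = j'` (kernel computation on `Fin 4 → ℤ`). -/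
theorem single_inj : ∀ j j' : Fin 4, (Pi.single j (1 : ℤ) : Site 4) = Pi.single j' 1 → j = j' := by
  decide

/-- Unit vectors: `e_j + e_{j'} ≠ 0` (kernel computation on `Fin 4 → ℤ`). -/
theorem single_add_single_ne_zero : ∀ j j' : Fin 4,
    (Pi.single j (1 : ℤ) : Site 4) + Pi.single j' 1 ≠ 0 := by
  decide

/-- Unit vectors: `±e_{j₁} ≠ e_j ± e_{j₂}` (kernel computation on `Fin 4 → ℤ`). -/
theorem single_ne_single_add : ∀ j j₁ j₂ : Fin 4,
    (Pi.single j₁ (1 : ℤ) : Site 4) ≠ Pi.single j 1 + Pi.single j₂ 1 ∧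
    (Pi.single j₁ (1 : ℤ) : Site 4) + Pi.single j₂ 1 ≠ Pi.single j 1 ∧
    (Pi.single j (1 : ℤ) : Site 4) + Pi.single j₂ 1 + Pi.single j₁ 1 ≠ 0 ∧
    (Pi.single j (1 : ℤ) : Site 4) + Pi.single j₁ 1 ≠ Pi.single j₂ 1 := by
  decide

/-- **A temporal bond lies only in temporal plaquettes of its own slab.** If `(y, 0)` is a bond of
`q = (x; i, j)` then `i = 0`, `x₀ = y₀` and `y ∈ {x, x + e_j}`. [folklore] -/
theorem temporal_of_mem {q : ZdPlaquette 4} {y : Site 4}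
    (h : ((y, (0 : Fin 4)) : ZdEdge 4) ∈ plaquetteEdges q) :
    q.2.1.1 = 0 ∧ q.1 0 = y 0 ∧ (y = q.1 ∨ y = q.1 + Pi.single q.2.1.2 1) := by
  have hij : q.2.1.1 < q.2.1.2 := q.2.2
  have hj0 : q.2.1.2 ≠ 0 := snd_ne_zero' q
  rw [mem_plaquetteEdges_iff] at h
  rcases h with h | h | h | h
  · obtain ⟨h1, h2⟩ := Prod.mk.inj h
    exact ⟨h2.symm, by rw [h1], Or.inl h1⟩
  · obtain ⟨-, h2⟩ := Prod.mk.inj h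
    exact absurd h2.symm hj0
  · obtain ⟨h1, h2⟩ := Prod.mk.inj h
    refine ⟨h2.symm, ?_, Or.inr h1⟩
    rw [h1, Pi.add_apply, Pi.single_eq_of_ne (Ne.symm hj0), add_zero]
  · obtain ⟨-, h2⟩ := Prod.mk.inj h
    exact absurd h2.symm hj0

/-- The first temporal bond `(x, 0)` of a temporal plaquette `(x; 0, j)`. [folklore] -/
theorem fst_mem {q : ZdPlaquette 4} (ht : q.2.1.1 = 0) :
    ((q.1, (0 : Fin 4)) : ZdEdge 4) ∈ plaquetteEdges q := by
  rw [mem_plaquetteEdges_iff]; exact Or.inl (by rw [ht])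

/-- The second temporal bond `(x + e_j, 0)` of a temporal plaquette `(x; 0, j)`. [folklore] -/
theorem snd_mem {q : ZdPlaquette 4} (ht : q.2.1.1 = 0) :
    ((q.1 + Pi.single q.2.1.2 1, (0 : Fin 4)) : ZdEdge 4) ∈ plaquetteEdges q := by
  rw [mem_plaquetteEdges_iff]; exact Or.inr (Or.inr (Or.inl (by rw [ht])))

/-- The two temporal bonds of a plaquette containing two distinct temporal bonds. [folklore] -/
theorem two_temporal {q : ZdPlaquette 4} {y y' : Site 4} (hy : y ≠ y')
    (h1 : ((y, (0 : Fin 4)) : ZdEdge 4) ∈ plaquetteEdges q)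
    (h2 : ((y', (0 : Fin 4)) : ZdEdge 4) ∈ plaquetteEdges q) :
    q.2.1.1 = 0 ∧ ((y = q.1 ∧ y' = q.1 + Pi.single q.2.1.2 1) ∨
      (y = q.1 + Pi.single q.2.1.2 1 ∧ y' = q.1)) := by
  obtain ⟨ht, -, hy1⟩ := temporal_of_mem h1
  obtain ⟨-, -, hy2⟩ := temporal_of_mem h2
  refine ⟨ht, ?_⟩
  rcases hy1 with ha | ha <;> rcases hy2 with hb | hb
  · exact absurd (ha.trans hb.symm) hy
  · exact Or.inl ⟨ha, hb⟩
  · exact Or.inr ⟨ha, hb⟩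
  · exact absurd (ha.trans hb.symm) hy

/-- **Two distinct temporal bonds determine the plaquette**: if `(y,0) ≠ (y',0)` are bonds of both
`q` and `q'`, then `q = q'`. [folklore] -/
theorem eq_of_two_temporal {q q' : ZdPlaquette 4} {y y' : Site 4} (hy : y ≠ y')
    (h1 : ((y, (0 : Fin 4)) : ZdEdge 4) ∈ plaquetteEdges q)
    (h2 : ((y', (0 : Fin 4)) : ZdEdge 4) ∈ plaquetteEdges q)
    (h1' : ((y, (0 : Fin 4)) : ZdEdge 4) ∈ plaquetteEdges q')
    (h2' : ((y', (0 : Fin 4)) : ZdEdge 4) ∈ plaquetteEdges q') : q = q' := by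
  obtain ⟨ht, hq⟩ := two_temporal hy h1 h2
  obtain ⟨ht', hq'⟩ := two_temporal hy h1' h2'
  rcases hq with ⟨ha, hb⟩ | ⟨ha, hb⟩ <;> rcases hq' with ⟨ha', hb'⟩ | ⟨ha', hb'⟩
  · have hx : q.1 = q'.1 := ha.symm.trans ha'
    rw [hx] at hb
    have hj : q.2.1.2 = q'.2.1.2 := single_inj _ _ (add_left_cancel (hb.symm.trans hb'))
    exact plaquette_ext hx (by rw [ht, ht']) hj
  · exfalso
    -- y' = y + e_j, y = y' + e_j'
    rw [← ha] at hb
    rw [← hb'] at ha'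
    rw [ha', add_assoc] at hb
    have : (Pi.single q'.2.1.2 (1 : ℤ) : Site 4) + Pi.single q.2.1.2 1 = 0 := by
      have := congrArg (fun z => z - y') hb
      simpa using this.symm
    exact single_add_single_ne_zero _ _ this
  · exfalso
    -- y = y' + e_j, y' = y + e_j'
    rw [← hb] at ha
    rw [← ha'] at hb'
    rw [hb', add_assoc] at ha
    have : (Pi.single q'.2.1.2 (1 : ℤ) : Site 4) + Pi.single q.2.1.2 1 = 0 := by
      have := congrArg (fun z => z - y) ha
      simpa using this.symm
    exact single_add_single_ne_zero _ _ this
  · have hx : q.1 = q'.1 := hb.symm.trans hb'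
    rw [hx] at ha
    have hj : q.2.1.2 = q'.2.1.2 := single_inj _ _ (add_left_cancel (ha.symm.trans ha'))
    exact plaquette_ext hx (by rw [ht, ht']) hj

/-- A unit step changes the site: `x + e_j ≠ x`. [folklore] -/
theorem add_single_ne (x : Site 4) (j : Fin 4) : x + Pi.single j 1 ≠ x := by
  intro h
  have h1 := congrFun h j
  simp at h1

/-! ## Four temporal plaquettes in every occupied slab -/

/-- **Four temporal plaquettes per occupied slab.** In a family `T` without private bonds, a
temporal plaquette `p` of `T` (plane `(0, j)`, slab `k = p.1 0`) comes with three further temporal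
plaquettes of `T` in the same slab: second plaquettes through its two temporal bonds, and a second
plaquette through the far temporal bond of one of them (the four are distinct because `ℤ³` has no
triangles). [folklore] -/
theorem four_in_slab (T : Finset (ZdPlaquette 4))
    (hN : ∀ p ∈ T, ∀ ℓ ∈ plaquetteEdges p, ∃ p' ∈ T, p' ≠ p ∧ ℓ ∈ plaquetteEdges p')
    {p : ZdPlaquette 4} (hp : p ∈ T) (ht : p.2.1.1 = 0) :
    ∃ S : Finset (ZdPlaquette 4), S ⊆ T ∧ S.card = 4 ∧ ∀ q ∈ S, q.2.1.1 = 0 ∧ q.1 0 = p.1 0 := by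
  classical
  have hj0 : p.2.1.2 ≠ 0 := snd_ne_zero' p
  have huv : p.1 ≠ p.1 + Pi.single p.2.1.2 1 := (add_single_ne _ _).symm
  obtain ⟨p₁, hp₁T, hp₁ne, hu₁⟩ := hN p hp _ (fst_mem ht)
  obtain ⟨p₂, hp₂T, hp₂ne, hv₂⟩ := hN p hp _ (snd_mem ht)
  obtain ⟨ht₁, hk₁, hy₁⟩ := temporal_of_mem hu₁
  obtain ⟨ht₂, hk₂, -⟩ := temporal_of_mem hv₂
  have h12 : p₁ ≠ p₂ := by
    rintro rfl
    exact hp₁ne (eq_of_two_temporal huv hu₁ hv₂ (fst_mem ht) (snd_mem ht))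
  -- the other temporal bond `(yw, 0)` of `p₁`
  obtain ⟨yw, hw₁, hyw⟩ : ∃ yw : Site 4, ((yw, (0 : Fin 4)) : ZdEdge 4) ∈ plaquetteEdges p₁ ∧
      (yw = p.1 + Pi.single p₁.2.1.2 1 ∨ p.1 = yw + Pi.single p₁.2.1.2 1) := by
    rcases hy₁ with h | h
    · exact ⟨p₁.1 + Pi.single p₁.2.1.2 1, snd_mem ht₁, Or.inl (by rw [h])⟩
    · exact ⟨p₁.1, fst_mem ht₁, Or.inr h⟩
  have hj₁ : p₁.2.1.2 ≠ 0 := snd_ne_zero' p₁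
  have huw : p.1 ≠ yw := by
    rcases hyw with h | h
    · rw [h]; exact (add_single_ne _ _).symm
    · intro h'; rw [← h'] at h; exact (add_single_ne _ _) h.symm
  obtain ⟨p₃, hp₃T, hp₃ne, hw₃⟩ := hN p₁ hp₁T _ hw₁
  obtain ⟨ht₃, hk₃, -⟩ := temporal_of_mem hw₃
  have h3p : p₃ ≠ p := by
    rintro rfl
    exact hp₁ne (eq_of_two_temporal huw hu₁ hw₁ (fst_mem ht) hw₃)
  have hvw : p.1 + Pi.single p.2.1.2 1 ≠ yw := by
    intro h
    rw [← h] at hw₁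
    exact hp₁ne (eq_of_two_temporal huv hu₁ hw₁ (fst_mem ht) (snd_mem ht))
  have h32 : p₃ ≠ p₂ := by
    intro h33
    rw [h33] at hw₃
    obtain ⟨-, hq⟩ := two_temporal hvw hv₂ hw₃
    obtain ⟨h1, h2, h3, h4⟩ := single_ne_single_add p.2.1.2 p₁.2.1.2 p₂.2.1.2
    rcases hq with ⟨ha, hb⟩ | ⟨ha, hb⟩ <;> rcases hyw with hc | hc
    · -- v = x₂, w = x₂ + e₂, w = x + e₁
      rw [← ha, hc, add_assoc] at hb
      exact h1 (add_left_cancel hb)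
    · -- v = x₂, w = x₂ + e₂, x = w + e₁
      rw [← ha] at hb
      rw [hb, add_assoc, add_assoc] at hc
      have : (Pi.single p.2.1.2 (1 : ℤ) : Site 4) + (Pi.single p₂.2.1.2 1 + Pi.single p₁.2.1.2 1) = 0 := by
        have := congrArg (fun z => z - p.1) hc
        simpa using this.symm
      exact h3 (by rw [← add_assoc] at this; exact this)
    · -- v = x₂ + e₂, w = x₂, w = x + e₁
      rw [← hb] at ha
      rw [hc, add_assoc] at ha
      exact h2 (add_left_cancel ha).symm
    · -- v = x₂ + e₂, w = x₂, x = w + e₁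
      rw [← hb] at ha
      rw [hc, add_assoc] at ha
      have := add_left_cancel ha
      exact h4 (by rw [add_comm]; exact this)
  refine ⟨{p, p₁, p₂, p₃}, ?_, ?_, ?_⟩
  · intro q hq
    simp only [Finset.mem_insert, Finset.mem_singleton] at hq
    rcases hq with rfl | rfl | rfl | rfl <;> assumption
  · rw [Finset.card_insert_of_notMem, Finset.card_insert_of_notMem, Finset.card_pair h32.symm]
    · simp only [Finset.mem_insert, Finset.mem_singleton, not_or]
      exact ⟨h12, fun h => hp₃ne h.symm⟩
    · simp only [Finset.mem_insert, Finset.mem_singleton, not_or]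
      exact ⟨fun h => hp₁ne h.symm, fun h => hp₂ne h.symm, fun h => h3p h.symm⟩
  · intro q hq
    simp only [Finset.mem_insert, Finset.mem_singleton] at hq
    rcases hq with rfl | rfl | rfl | rfl
    · exact ⟨ht, rfl⟩
    · exact ⟨ht₁, hk₁⟩
    · refine ⟨ht₂, ?_⟩
      rw [hk₂, Pi.add_apply, Pi.single_eq_of_ne (Ne.symm hj0), add_zero]
    · refine ⟨ht₃, ?_⟩
      rw [hk₃]
      rcases hyw with h | h
      · rw [h, Pi.add_apply, Pi.single_eq_of_ne (Ne.symm hj₁), add_zero]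
      · have := congrFun h 0
        rw [Pi.add_apply, Pi.single_eq_of_ne (Ne.symm hj₁), add_zero] at this
        rw [this]

/-! ## Connected families pass through slab one -/

/-- **Slab propagation.** If `T` has no temporal plaquette in slab `1`, link adjacency through `T`
preserves the property "temporal bonds in slabs `≤ 0`, spatial bonds at heights `≤ 1`".
[folklore] -/
theorem low_of_linkAdj (T : Finset (ZdPlaquette 4)) (hT1 : ∀ p ∈ T, p.2.1.1 = 0 → p.1 0 ≠ 1)
    {ℓ ℓ' : ZdEdge 4} (h : LinkAdj T ℓ ℓ')
    (hℓ : (ℓ.2 = 0 → ℓ.1 0 ≤ 0) ∧ (ℓ.2 ≠ 0 → ℓ.1 0 ≤ 1)) :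
    (ℓ'.2 = 0 → ℓ'.1 0 ≤ 0) ∧ (ℓ'.2 ≠ 0 → ℓ'.1 0 ≤ 1) := by
  obtain ⟨p, hp, h1, h2⟩ := h
  have hj0 : p.2.1.2 ≠ 0 := snd_ne_zero' p
  have ej0 : (Pi.single p.2.1.2 (1 : ℤ) : Site 4) 0 = 0 := Pi.single_eq_of_ne (Ne.symm hj0) _
  -- the plaquette inherits the bound from `ℓ`
  have hΦ : (p.2.1.1 = 0 → p.1 0 ≤ 0) ∧ (p.2.1.1 ≠ 0 → p.1 0 ≤ 1) := by
    rw [mem_plaquetteEdges_iff] at h1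
    rcases h1 with rfl | rfl | rfl | rfl
    · exact hℓ
    · have h := hℓ.2 hj0
      simp only [Pi.add_apply] at h
      constructor
      · intro hi; rw [hi, Pi.single_eq_same] at h; linarith
      · intro hi; rw [Pi.single_eq_of_ne (Ne.symm hi), add_zero] at h; exact h
    · constructor
      · intro hi; have h := hℓ.1 hi; simp only [Pi.add_apply] at h; rw [ej0, add_zero] at h; exact h
      · intro hi; have h := hℓ.2 hi; simp only [Pi.add_apply] at h; rw [ej0, add_zero] at h; exact h
    · have h := hℓ.2 hj0
      simp only at h
      constructor
      · intro hi
        have hne := hT1 p hp hi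
        omega
      · intro; exact h
  -- and passes it to `ℓ'`
  rw [mem_plaquetteEdges_iff] at h2
  rcases h2 with rfl | rfl | rfl | rfl
  · exact hΦ
  · simp only [Pi.add_apply]
    refine ⟨fun h => absurd h hj0, fun _ => ?_⟩
    by_cases hi : p.2.1.1 = 0
    · rw [hi, Pi.single_eq_same]; have := hΦ.1 hi; linarith
    · rw [Pi.single_eq_of_ne (Ne.symm hi), add_zero]; exact hΦ.2 hi
  · simp only [Pi.add_apply]; rw [ej0, add_zero]; exact hΦ
  · refine ⟨fun h => absurd h hj0, fun _ => ?_⟩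
    by_cases hi : p.2.1.1 = 0
    · have := hΦ.1 hi; simp only; linarith
    · exact hΦ.2 hi

/-- **A connected family through `A = (0;0,1)` and `B₂ = (2e₀;0,1)` has a temporal plaquette in
slab `1`**: every bond of `A` is "low" (temporal in slab `≤ 0` or spatial at height `≤ 1`), no
bond of `B₂` is, and without slab-`1` temporal plaquettes link adjacency preserves lowness.
[folklore] -/
theorem exists_slab_one (T : Finset (ZdPlaquette 4))
    (hJ : ∃ e₁ ∈ plaquetteEdges ((![0,0,0,0], ⟨(0, 1), lt01⟩) : ZdPlaquette 4),
      ∃ e₂ ∈ plaquetteEdges ((![2,0,0,0], ⟨(0, 1), lt01⟩) : ZdPlaquette 4),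
        Relation.ReflTransGen (LinkAdj T) e₁ e₂) :
    ∃ p ∈ T, p.2.1.1 = 0 ∧ p.1 0 = 1 := by
  by_contra hcon
  push Not at hcon
  obtain ⟨e₁, he₁, e₂, he₂, hpath⟩ := hJ
  have hA : ∀ e ∈ plaquetteEdges ((![0,0,0,0], ⟨(0, 1), lt01⟩) : ZdPlaquette 4),
      (e.2 = 0 → e.1 0 ≤ 0) ∧ (e.2 ≠ 0 → e.1 0 ≤ 1) := by decide
  have hB : ∀ e ∈ plaquetteEdges ((![2,0,0,0], ⟨(0, 1), lt01⟩) : ZdPlaquette 4),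
      ¬ ((e.2 = 0 → e.1 0 ≤ 0) ∧ (e.2 ≠ 0 → e.1 0 ≤ 1)) := by decide
  have hlow : ∀ e, Relation.ReflTransGen (LinkAdj T) e₁ e →
      (e.2 = 0 → e.1 0 ≤ 0) ∧ (e.2 ≠ 0 → e.1 0 ≤ 1) := by
    intro e he
    induction he with
    | refl => exact hA e₁ he₁
    | tail _ hadj ih => exact low_of_linkAdj T hcon hadj ih
  exact hB e₂ he₂ (hlow e₂ hpath)

end Summit.QuantumFields.YangMills.Theorems.S28DistanceTwo

end
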